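import Summits.RiemannHypothesis.RiemannHypothesis.Theorems.OddSectorOddOneSignedWindowsSmallWindow
import Summits.RiemannHypothesis.RiemannHypothesis.Theorems.OddSectorOddOneSignedWindowsGoodWindowsClosed
import Summits.RiemannHypothesis.RiemannHypothesis.Theorems.OddSectorOddOneSignedWindowsExistence
import HarnessLib

/-!
# The crux `OddOneSignedWindows` or a first bad height (structure of the good-window set)
# (helper for crux `OddSector.OddOneSignedWindows`, item stmt-RiemannHypothesis-17778; RH-free)

Call a window `a > 0` GOOD when it carries a one-signed real odd-sector ground state (the matrix of
the route crux `OddSector.OddOneSignedWindows`, which asks for the good set to be unbounded). Two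
RH-free facts are in the tree: every window `0 < a ≤ ½ log 2` is good
(`exists_isWeilOddGroundState_oneSigned_of_two_mul_le_log_two`, fold below the first prime) and the
good set is sequentially closed in `(0, ∞)` (`goodWindows_seqClosed`, compactness of ground states
under window dilation). Together they give the following DICHOTOMY
(`oddOneSignedWindows_or_exists_firstBadHeight`): either the crux holds, or there is a FIRST BAD
HEIGHT `b ≥ ½ log 2` — every window in `(0, b]` is good (in particular `b` itself, by closedness)
while bad windows accumulate at `b` from the right. In the second case the failure of
one-signedness starts by "touchdown": along bad windows `aₖ ↓ b` every real odd ground state has a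
sign-opposed reflected prime pair (`oddOneSignedWindows_iff_noOpposedReflections`), although the
limit window `b` carries a one-signed ground state (cf. the 2001 programme's Cor. 10.4 analogue and
the origin cusp at `a = log q`).

References: 2001 programme, route `odd-sector-eigenfunction-sign` (ATTEMPTS 2026-08-10);
this route's helper files SmallWindow / GoodWindowsClosed (2026-08-17).
-/

noncomputable section

set_option linter.dupNamespace false

open MeasureTheory Set Filter
open scoped Topology

namespace Summit.RiemannHypothesis.RiemannHypothesis.Theorems.OddSector

open Literature.NumberTheory.LFunctions

/-- **Dichotomy: the crux, or a first bad height (registered sub-goal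
`oddOneSignedWindows_or_exists_firstBadHeight` of item stmt-RiemannHypothesis-17778; RH-free).**
Either `OddOneSignedWindows` holds, or there is a height `b ≥ ½ log 2` such that every window
`0 < a ≤ b` carries a one-signed real odd-sector ground state while in every right neighbourhood
`(b, b + δ)` some window carries none. (Good windows contain `(0, ½ log 2]` and form a sequentially
closed subset of `(0, ∞)`; if they are bounded, `b` is the supremum of the heights below which all
windows are good.) [folklore] -/
theorem oddOneSignedWindows_or_exists_firstBadHeight :
    Summit.RiemannHypothesis.RiemannHypothesis.Theses.OddSector.OddOneSignedWindows ∨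
      ∃ b : ℝ, Real.log 2 / 2 ≤ b ∧
        (∀ a : ℝ, 0 < a → a ≤ b → ∃ u : ℝ → ℂ, IsWeilOddGroundState a u ∧
          ∀ᵐ t : ℝ, t ∈ Ioo 0 a → (u t).im = 0 ∧ 0 ≤ (u t).re) ∧
        ∀ δ : ℝ, 0 < δ → ∃ a : ℝ, b < a ∧ a < b + δ ∧ ¬ ∃ u : ℝ → ℂ, IsWeilOddGroundState a u ∧
          ∀ᵐ t : ℝ, t ∈ Ioo 0 a → (u t).im = 0 ∧ 0 ≤ (u t).re := by
  classical
  -- `good a`: the window `a` carries a one-signed real odd ground state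
  set good : ℝ → Prop := fun a ↦ ∃ u : ℝ → ℂ, IsWeilOddGroundState a u ∧
    ∀ᵐ t : ℝ, t ∈ Ioo 0 a → (u t).im = 0 ∧ 0 ≤ (u t).re with hgood_def
  by_cases hS : Summit.RiemannHypothesis.RiemannHypothesis.Theses.OddSector.OddOneSignedWindows
  · exact Or.inl hS
  right
  -- small windows are good
  have hsmall : ∀ a : ℝ, 0 < a → 2 * a ≤ Real.log 2 → good a := fun a ha h2 ↦
    exists_isWeilOddGroundState_oneSigned_of_two_mul_le_log_two ha h2
  have hlog2 : 0 < Real.log 2 := Real.log_pos (by norm_num)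
  -- beyond some height `A > 0` no window is good
  obtain ⟨A, hApos, hA⟩ : ∃ A : ℝ, 0 < A ∧ ∀ a : ℝ, A ≤ a → ¬ good a := by
    by_contra hcon
    apply hS
    rw [oddOneSignedWindows_iff]
    intro A
    by_contra hnone
    exact hcon ⟨max A 1, lt_max_of_lt_right one_pos, fun a ha hg ↦
      hnone ⟨a, (le_max_left A 1).trans ha, hg⟩⟩
  -- `S`: heights below which every window is good; `b := sup S`
  set S : Set ℝ := {c : ℝ | ∀ a : ℝ, 0 < a → a ≤ c → good a} with hS_def
  have hmemS : Real.log 2 / 2 ∈ S := fun a ha hac ↦ hsmall a ha (by linarith)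
  have hSne : S.Nonempty := ⟨_, hmemS⟩
  have hSbdd : BddAbove S := by
    refine ⟨A, fun c hc ↦ ?_⟩
    by_contra hlt
    push Not at hlt
    exact hA A le_rfl (hc A hApos hlt.le)
  set b : ℝ := sSup S with hb_def
  have hb_ge : Real.log 2 / 2 ≤ b := le_csSup hSbdd hmemS
  have hb_pos : 0 < b := lt_of_lt_of_le (by positivity) hb_ge
  -- every window strictly below `b` is good
  have hbelow : ∀ a : ℝ, 0 < a → a < b → good a := by
    intro a ha hab
    obtain ⟨c, hcS, hac⟩ := exists_lt_of_lt_csSup hSne hab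
    exact hcS a ha hac.le
  -- `b` itself is good, by sequential closedness along `b (1 - 1/(n+2)) ↑ b`
  have hb_good : good b := by
    have hseq : ∀ n : ℕ, good (b * (1 - 1 / ((n : ℝ) + 2))) := by
      intro n
      have hn : (0 : ℝ) < (n : ℝ) + 2 := by positivity
      have h1 : 0 < 1 - 1 / ((n : ℝ) + 2) := by
        rw [sub_pos, div_lt_one hn]; linarith
      have h2 : 1 - 1 / ((n : ℝ) + 2) < 1 := by
        have : 0 < 1 / ((n : ℝ) + 2) := by positivity
        linarith
      exact hbelow _ (mul_pos hb_pos h1) (by nlinarith)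
    have htend : Tendsto (fun n : ℕ ↦ b * (1 - 1 / ((n : ℝ) + 2))) atTop (𝓝 b) := by
      have h0 : Tendsto (fun n : ℕ ↦ 1 / ((n : ℝ) + 2)) atTop (𝓝 0) := by
        have := tendsto_one_div_add_atTop_nhds_zero_nat (𝕜 := ℝ)
        refine (this.comp (tendsto_add_atTop_nat 1)).congr fun n ↦ ?_
        simp only [Function.comp_apply, Nat.cast_add, Nat.cast_one]
        ring
      have : Tendsto (fun n : ℕ ↦ b * (1 - 1 / ((n : ℝ) + 2))) atTop (𝓝 (b * (1 - 0))) :=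
        (h0.const_sub 1).const_mul b
      simpa using this
    exact goodWindows_seqClosed b _ hb_pos htend hseq
  refine ⟨b, hb_ge, fun a ha hab ↦ ?_, fun δ hδ ↦ ?_⟩
  · rcases hab.lt_or_eq with hlt | heq
    · exact hbelow a ha hlt
    · rw [heq]; exact hb_good
  · -- if every window in `(b, b + δ)` were good, `b + δ/2 ∈ S` would exceed `sup S`
    by_contra hnone
    push Not at hnone
    have hmem : b + δ / 2 ∈ S := by
      intro a ha hale
      rcases le_or_gt a b with hab | hba
      · rcases hab.lt_or_eq with hlt | heq
        · exact hbelow a ha hlt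
        · rw [heq]; exact hb_good
      · exact hnone a hba (by linarith)
    have : b + δ / 2 ≤ b := le_csSup hSbdd hmem
    linarith

end Summit.RiemannHypothesis.RiemannHypothesis.Theorems.OddSector

end
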